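import Summits.Langlands.Langlands.Theorems.IrreducibilityBySelfDualityReciprocityUpToIrreducibilityWeakAutomorphy
import Literature.NumberTheory.GaloisRepresentations.PstWeilDeligneModelIndependence
import Literature.NumberTheory.Automorphic.ReciprocityGLnQlModelProofs
import HarnessLib

/-!
# `ReciprocityUpToIrreducibility` (item stmt-Langlands-14328), line `Sketch`: the registered stub
`stub_weakAutomorphy_of_fontaineMazurLanglandsGLn` — B_w verbatim from lang.S03 at the pinned datum

The line's open stub `stub_weakAutomorphy` (B_w: every irreducible `ρ : Γ_K → GL_n(ℚ̄_ℓ)` which is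
unramified almost everywhere and de Rham above `ℓ` for the summit's PINNED `p`-adic Hodge datum
`Literature.NumberTheory.PAdicHodge.fontainePstAdicCompletion v ℓ hv` is Satake–Frobenius compatible
almost everywhere with some L-algebraic cuspidal `π` of `GL_n(𝔸_K)`) is the almost-everywhere form of
the Fontaine–Mazur–Langlands conjecture.  The tree holds that conjecture as the accepted Literature
text lang.S03 `Literature.NumberTheory.Automorphic.FontaineMazurLanglandsGLn 𝔅 n` (relative to a family
of period-ring data `𝔅`).  The accepted file
`…Theorems.IrreducibilityBySelfDualityReciprocityUpToIrreducibilityWeakAutomorphy` instantiated lang.S03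
at the pinned family and recorded the only remaining difference between the two statements: lang.S03
asks geometricity of the `ℚ_ℓ`-restriction of ONE GLOBAL finite model `rE` of `ρ`, B_w asks de
Rham-ness place by place through LOCAL finite models (`IsDeRhamFramed`).  Both halves of that gap are
now theorems of the tree:

* unramified half — `isUnramifiedAE_restrictScalarsQl_of_hasQlModel` (same accepted file);
* de Rham half — `Literature.NumberTheory.GaloisRepresentations.FramedGaloisRep.isDeRham_toLocal_restrictScalarsQl`
  (accepted `PstWeilDeligneModelIndependence`: de Rham-ness does not depend on the finite model,
  Fontaine 1994 Exp. III Prop. 1.5.2, and a global model restricts to a local one);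
* the global finite model itself — `Literature.NumberTheory.Automorphic.exists_hasQlModel_holds`
  (Baire category, Buzzard–Gee 2014 footnote to Conj. 3.2.1; accepted discharge).

Hence this file proves the stub REGISTERED on the crux item under the name
`stub_weakAutomorphy_of_fontaineMazurLanglandsGLn`, with its registered signature verbatim:
lang.S03 for every rank at the pinned family implies B_w.  B_w itself stays OPEN (it is now exactly a
named accepted conjecture text of the tree); nothing here proves lang.S03.

No definitions; axioms `propext`, `Classical.choice`, `Quot.sound`.
-/

noncomputable section

set_option linter.dupNamespace false -- project-wide option (lakefile weak.linter.dupNamespace); `Summit.Langlands.Langlands` is the mandated namespace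

open scoped NumberField Classical Polynomial
open Filter IsDedekindDomain Polynomial
open Literature.NumberTheory.Automorphic Literature.NumberTheory.GaloisRepresentations
open Summit.Langlands

namespace Summit.Langlands.Langlands.Theorems.ReciprocityUpToIrreducibility

/-- **B_w (the line's `stub_weakAutomorphy`, verbatim) from lang.S03 at the pinned datum.**  If the
accepted Fontaine–Mazur–Langlands text `FontaineMazurLanglandsGLn 𝔅 n` holds for every rank `n` at the
pinned family `𝔅 K ℓ v hv := ⟨(fontainePstAdicCompletion v ℓ hv).algebra, (fontainePstAdicCompletion v ℓ hv).𝔅⟩`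
(Fontaine's `B_dR(K_v)` with the canonical `ℚ_ℓ`-structure, as pinned by the summit), then every
irreducible `ρ : Γ_K → GL_n(ℚ̄_ℓ)` which is unramified at almost all places and pinned-de Rham at every
`v ∣ ℓ` is Satake–Frobenius compatible at almost all places with some L-algebraic cuspidal `π` of
`GL_n(𝔸_K)`.  Proof: choose a global finite model `rE` of `ρ` over a finite `E/ℚ_ℓ`
(`exists_hasQlModel_holds`); its `ℚ_ℓ`-restriction is unramified almost everywhere
(`isUnramifiedAE_restrictScalarsQl_of_hasQlModel`) and de Rham at every `v ∣ ℓ` for the pinned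
period-ring datum (`FramedGaloisRep.isDeRham_toLocal_restrictScalarsQl`, model independence of de
Rham-ness), i.e. `IsGeometric` for the pinned family; apply lang.S03 through
`weakAutomorphy_of_fontaineMazurLanglandsGLn`.  The rank hypothesis `0 < n` of the registered
signature is not needed.  [cite: FontaineMazurGeometric1995, Conj. 1]
[cite: BuzzardGeeLMS2014, Conj. 3.2.2 and §2.2] [cite: FontaineAsterisque223III, Prop. 1.5.2] -/
theorem stub_weakAutomorphy_of_fontaineMazurLanglandsGLn :
    (∀ n : ℕ, FontaineMazurLanglandsGLn
      (fun (K : Type) [Field K] [NumberField K] (ℓ : ℕ) [Fact ℓ.Prime]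
          (v : HeightOneSpectrum (𝓞 K)) (hv : ((ℓ : ℕ) : 𝓞 K) ∈ v.asIdeal) =>
        ⟨(Literature.NumberTheory.PAdicHodge.fontainePstAdicCompletion v ℓ hv).algebra,
          (Literature.NumberTheory.PAdicHodge.fontainePstAdicCompletion v ℓ hv).𝔅⟩) n) →
    ∀ (K : Type) [Field K] [NumberField K] (n : ℕ) (hcpt : isCompact_glFiniteIntegralLevel n K),
      0 < n → ∀ (ℓ : ℕ) [Fact ℓ.Prime] (ι : PadicAlgCl ℓ ≃+* ℂ) (ρ : FramedGaloisRep K (PadicAlgCl ℓ) n),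
        ρ.toGaloisRep.IsIrreducible →
        ((∀ᶠ v : HeightOneSpectrum (𝓞 K) in cofinite, ρ.IsUnramifiedAt v) ∧
          ∀ (v : HeightOneSpectrum (𝓞 K)) (hv : ((ℓ : ℕ) : 𝓞 K) ∈ v.asIdeal),
            (Literature.NumberTheory.PAdicHodge.fontainePstAdicCompletion v ℓ hv).IsDeRhamFramed
              (ρ.toLocal v)) →
          ∃ π : CuspidalAutomorphicRepData n K hcpt, π.1.IsLAlgebraic ∧
            ∀ᶠ v : HeightOneSpectrum (𝓞 K) in cofinite, SatakeFrobCompatibleAt ι π.1 ρ v := by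
  intro h K _ _ n hcpt _hn ℓ _ ι ρ hirr hgeo
  obtain ⟨E, rE, hfin, hmodel⟩ := exists_hasQlModel_holds ρ
  haveI := hfin
  refine weakAutomorphy_of_fontaineMazurLanglandsGLn (h n) hcpt ι ρ hirr E rE hmodel ⟨?_, ?_⟩
  · exact isUnramifiedAE_restrictScalarsQl_of_hasQlModel hmodel hgeo.1
  · intro v hv
    exact FramedGaloisRep.isDeRham_toLocal_restrictScalarsQl hmodel v _ _ (hgeo.2 v hv)

end Summit.Langlands.Langlands.Theorems.ReciprocityUpToIrreducibility

end
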